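import Literature.AlgebraicGeometry.AbelianSchemes.SerreTwistFamilyCover   -- ★ rows (t1)(t1′)(t2)(t4) of the Serre cover `ψ_P`, any base
import HarnessLib

/-!
# The rows of the Serre cover `ψ_P : A → A ⊗_𝒪 𝔞⁻¹` that need ONLY a presentation of `𝔞` (no Rosati pair, no dual pair, no level)
# ([RapoportSmithlingZhang2020Diagonal] (4.23); [Conrad2004GrossZagier] §7 Thm. 7.5; [MilneCM2006] §7)

Topic `AlgebraicGeometry/AbelianSchemes`, namespace `Literature.AlgebraicGeometry.AbelianSchemes.AbelianSchemeOver`.  THEOREMS ONLY (no definition, no instance,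
no named fact, no `sorry`).  Cell `hodgecm-mathlib` (D-0151), P6 «MOD programme», crux hLiu418 (stmt-HodgeConjecture-24832, `--supports`, count-neutral), closer
`Lines/F0_P6a_StubESHEET.lean` socket `stub_SHEET`, road B′ «SERRE TENSOR PER COMPLEX FIBRE» (LA4-plan (g2) 07:43:53Z, A-p01 (g28) 07:44:27Z «=»; DEAL #32 LEG-B′ →
LA4-p03 (g2)): on B′ the cover `c₀ : A_x → A_x ⊗ 𝔞⁻¹` of ONE complex fibre is needed with the rows (t1) two-sided Serre presentation, (t1′) kernel `= A[𝔞]` on all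
`T`-points + surjectivity, (t2) upper bound through `(N) ⊇ y·𝔞`, (t4) `𝒪`-equivariance — and NOT the rows (t3)(t5) of ★ `exists_serreTwist_cover_rows`, whose inputs
(Rosati pair `1 − a ∈ 𝔞, b ∈ 𝔞`, i.e. `𝔞 + 𝔞̄ = 1`, and a dual pair of the twist) road B′ does not have (the polarisation ∕ level rows are READ through markings there,
★ p849931 ∕ p849861).  This file packages exactly those four rows from a Serre presentation `(E′, P, Q, N)` of `𝔞⁻¹` alone, over ANY base: **`serreCover_rows_of_presentation`**
(★ `serreTranslate_twoSided_presentation`, ★ `comp_serreTranslate_eq_one_iff_forall_mem`, ★ `surjective_serreTranslate_left`, ★ `exists_comp_serreAction_i_eq_of_mul_mem_span`,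
★ `i_comp_serreTranslate`).  HONEST LABEL: HC_CM is proved only modulo the 2 remaining named inputs (hLiu418 24832, h413 24833); count-neutral.

## References
* [RapoportSmithlingZhang2020Diagonal] M. Rapoport, B. Smithling, W. Zhang (2020), §3.2 (p. 11) and §4.3 (4.23) (p. 21).
* [Conrad2004GrossZagier] B. Conrad, *Gross–Zagier revisited* (2004), §7 Thm. 7.5.
* [MilneCM2006] J. S. Milne, *Complex Multiplication* (2006), §7 (Def. 7.19, Prop. 7.22, Rem. 7.23).
* [MumfordAV1970] D. Mumford, *Abelian Varieties* (1970), §7 Thm. 4 (p. 72).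
-/

set_option autoImplicit false

-- as the ★ Serre-tensor files: `Over`/`Scheme` wrappers and `Scheme.Modules` are semireducible
set_option backward.isDefEq.respectTransparency false

noncomputable section

universe u

open CategoryTheory CategoryTheory.Limits AlgebraicGeometry MonoidalCategory CartesianMonoidalCategory
open scoped MonObj

namespace Literature.AlgebraicGeometry.AbelianSchemes

namespace AbelianSchemeOver

/-- **THE PRESENTATION-ONLY ROWS OF THE SERRE COVER `ψ_P : A → A ⊗_𝒪 𝔞⁻¹`** over any base: for a Serre presentation `(E′, P, Q, N)` (`E′P = P`, `QE′ = Q`, `QP = N`,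
`PQ = N·E′`, `N ≠ 0`, coordinates of `P` generating `𝔞`, `𝒪` a domain of characteristic `0`) and `c₀ := ψ_P`: (t1) for `x ∈ 𝔞` a homomorphism `d` with
`c₀ ≫ d = ι(x)`, `d ≫ c₀ = ι_{A⊗𝔞⁻¹}(x)`; (t1′) `t ≫ c₀ = 1 ↔ ∀ x ∈ 𝔞, t ≫ ι(x) = 1` on all `T`-points, and `c₀` surjective; (t2) for `y` with `y·𝔞 ⊆ (N)` a homomorphism
`f` with `c₀ ≫ ι_{A⊗𝔞⁻¹}(y) = f ≫ ι_{A⊗𝔞⁻¹}(N)`; (t4) `ι(x) ≫ c₀ = c₀ ≫ ι_{A⊗𝔞⁻¹}(x)`.  (The four ★ row lemmas side by side — the Rosati-free, dual-free half of ★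
`exists_serreTwist_cover_rows`.) [cite: RapoportSmithlingZhang2020Diagonal, §3.2 (p. 11) and §4.3 (4.23) (p. 21)] [cite: Conrad2004GrossZagier, §7 (Thm. 7.5)]
[cite: MilneCM2006, §7 (Prop. 7.22, Rem. 7.23)] [cite: MumfordAV1970, §7 Thm. 4 (p. 72)] -/
theorem serreCover_rows_of_presentation {S : Scheme.{u}} {A : AbelianSchemeOver S} {O : Type*} [CommRing O] [IsDomain O] [CharZero O]
    (act : A.RingAction O) [IsCommMonObj A.X] {m : ℕ} (E' : Matrix (Fin m) (Fin m) O) (hE' : E' * E' = E') (P : Matrix (Fin m) (Fin 1) O)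
    (Q : Matrix (Fin 1) (Fin m) O) {N : ℕ} (hN : N ≠ 0) (hP : E' * P = P) (hQ : Q * E' = Q)
    (hQP : Q * P = Matrix.scalar (Fin 1) (N : O)) (hPQ : P * Q = Matrix.scalar (Fin m) (N : O) * E')
    {𝔞 : Ideal O} (h𝔞 : Ideal.span (Set.range fun k => P k 0) = 𝔞) :
    -- (t1) two-sided Serre presentation of `𝔞`
    (∀ x ∈ 𝔞, ∃ d : (serreTensor act E' hE').X ⟶ A.X, IsMonHom d ∧
      serreTranslate act E' hE' P ≫ d = act.i x ∧ d ≫ serreTranslate act E' hE' P = (serreAction act E' hE').i x) ∧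
    -- (t1′) the kernel of the cover is the `𝔞`-torsion, on all `T`-points; the cover is surjective
    (∀ ⦃T : Over S⦄ (t : T ⟶ A.X), t ≫ serreTranslate act E' hE' P = 1 ↔ ∀ x ∈ 𝔞, t ≫ act.i x = 1) ∧
    Function.Surjective (serreTranslate act E' hE' P).left.base ∧
    -- (t2) upper bound through `(N) ⊇ y·𝔞`
    (∀ y : O, (∀ x ∈ 𝔞, y * x ∈ Ideal.span {(N : O)}) → ∃ f : A.X ⟶ (serreTensor act E' hE').X, IsMonHom f ∧
      serreTranslate act E' hE' P ≫ (serreAction act E' hE').i y = f ≫ (serreAction act E' hE').i (N : O)) ∧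
    -- (t4) `𝒪`-equivariance of the cover
    (∀ x : O, act.i x ≫ serreTranslate act E' hE' P = serreTranslate act E' hE' P ≫ (serreAction act E' hE').i x) := by
  have hPmem : ∀ k, P k 0 ∈ 𝔞 := fun k => h𝔞 ▸ Ideal.subset_span ⟨k, rfl⟩
  haveI := surjective_serreTranslate_left act E' hE' P Q hN hP hQ hQP hPQ
  refine ⟨fun x hx => serreTranslate_twoSided_presentation act E' hE' P Q hN hP hQ hQP hPQ h𝔞 hx,
    fun T t => comp_serreTranslate_eq_one_iff_forall_mem act E' hE' P hP h𝔞 t, (serreTranslate act E' hE' P).left.surjective,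
    fun y hy => exists_comp_serreAction_i_eq_of_mul_mem_span act E' hE' P hN hP (fun k => hy _ (hPmem k)), fun x => i_comp_serreTranslate act E' hE' P hP x⟩

end AbelianSchemeOver

end Literature.AlgebraicGeometry.AbelianSchemes

end
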